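import Summits.CriticalPhenomena.SAWScalingLimit.Theorems.SAWDefectDecoherencePolygonParitySqueezeDefs
import Summits.CriticalPhenomena.SAWScalingLimit.Theorems.SAWDefectDecoherenceBoundaryClosureRGateMassLaws
import Summits.CriticalPhenomena.SAWScalingLimit.Theorems.SAWDevelopingMapObservableToSLETypeLadderTwoPieceAdmIdentificationFill
import HarnessLib

/-!
# Crux `BoundaryClosureR` (stmt-CriticalPhenomena-14004), line `polygon-parity-squeeze`,
# stub `stub_squeeze`: radius monotonicity of the pins and eventual membership in sub-domains

Landing target:
`Summits/CriticalPhenomena/SAWScalingLimit/Theorems/SAWDefectDecoherenceBoundaryClosureRSqueezeMembership.lean`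
(`--supports stmt-CriticalPhenomena-14004`).

The squeeze (B) of the line nests three domains `collarDomain D ρ' r' η δ (Λ δ) ⊆ Λ^P δ ⊆ Λ δ`
(collar-deleted domain, inner exact polygon, admissible family) and applies the model input
`GateCollarAvoidance` at radii `(ρ', r')` SMALLER than the pinned radii `(ρ, r₀)` of the datum
(there must be room for the inner polygon between the collar balls, which it has to contain, and
the pinned balls, inside which it has to stay flat).  This file supplies the two pieces of
bookkeeping this needs on top of `…BoundaryClosureRCollarDomain.lean`:

* **radius monotonicity of the pins** (`admissibleFamily_of_le`, `pinnedFlatRoot_of_le`): the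
  flat piece and the exact half-lattice on a pinned ball restrict to every smaller ball;
* **eventual membership in an ARBITRARY sub-domain keeping a ball** (the inner polygon family
  `Λ^P` is not itself a collar-deleted domain): a boundary family `e δ ∈ ∂(Λ δ)` with
  `δ·mid(e δ) → c` is eventually a boundary mid-edge of every `Λ' ⊆ Λ δ` keeping the faces of
  `Λ δ` with scaled centre in a fixed ball about `c` (`eventually_mem_boundary_of_keep`), and the
  domain mid-edges with scaled midpoint in `ball c r'`, `r' < r`, are eventually domain mid-edges
  of every sub-domain keeping `ball c r` (`eventually_midEdges_of_keep`);
* the registered bundle `squeeze_eventualMembership` (root, normaliser and gate targets survive in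
  the collar-deleted domain, eventually) as an instance of the generic lemmas (the sibling file
  `…BoundaryClosureRCollarDomain.lean` has the one-mesh versions for the collar-deleted domain).

Sources: H. Duminil-Copin, S. Smirnov, Ann. of Math. 175 (2012), §2 (domains, boundary
mid-edges).  Everything here is proved; no definition, no named fact.
-/

noncomputable section

open scoped BigOperators Topology Classical
open Filter Set
open Literature.Probability.LatticeModels (HexVertex hexGraph hexCenter)
open Literature.Probability.RandomPlanarGeometry
open Literature.Probability.RandomPlanarGeometry.SAW
open Summit.CriticalPhenomena.SAWScalingLimit.Theorems.PickHalfPlane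
open Summit.CriticalPhenomena.SAWScalingLimit.Theorems.ObservableToSLE.TypeLadder
  (mem_hexDomainBoundary_of_subset)

namespace Summit.CriticalPhenomena.SAWScalingLimit.Theorems.PolygonParitySqueeze

/-! ### 1. Radius monotonicity of the pins -/

/-- Shrinking a flat-piece identity `Ω ∩ B(c, r) = {im > im c} ∩ B(c, r)` to a smaller radius.
[folklore] -/
theorem flat_inter_ball_of_le {Ω : Set ℂ} {c : ℂ} {r r' : ℝ} (hle : r' ≤ r)
    (h : Ω ∩ Metric.ball c r = {z : ℂ | c.im < z.im} ∩ Metric.ball c r) :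
    Ω ∩ Metric.ball c r' = {z : ℂ | c.im < z.im} ∩ Metric.ball c r' := by
  ext z
  constructor
  · rintro ⟨hz, hzr⟩
    have h1 : z ∈ Ω ∩ Metric.ball c r := ⟨hz, Metric.ball_subset_ball hle hzr⟩
    rw [h] at h1
    exact ⟨h1.1, hzr⟩
  · rintro ⟨hz, hzr⟩
    have h1 : z ∈ {z : ℂ | c.im < z.im} ∩ Metric.ball c r := ⟨hz, Metric.ball_subset_ball hle hzr⟩
    rw [← h] at h1
    exact ⟨h1.1, hzr⟩

/-- **`AdmissibleFamily` is monotone in the radius**: the flat piece and the exact half-lattice on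
`B(pt 1, ρ)` restrict to every `B(pt 1, ρ')`, `0 < ρ' ≤ ρ`.
[cite: DuminilCopinSmirnov2012, §2 (domains) and Conjecture 2] -/
theorem admissibleFamily_of_le {D : DobrushinDomain} {ρ ρ' : ℝ} {Λ : ℝ → Finset HexVertex}
    {m : ℝ → ℤ} {b : ℝ → Sym2 HexVertex} (h : AdmissibleFamily D ρ Λ m b) (hρ' : 0 < ρ')
    (hle : ρ' ≤ ρ) : AdmissibleFamily D ρ' Λ m b := by
  obtain ⟨-, hflat, hev, hK, hb⟩ := h
  refine ⟨hρ', flat_inter_ball_of_le hle hflat, ?_, hK, hb⟩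
  filter_upwards [hev] with δ hδ
  exact ⟨hδ.1, hδ.2.1, hδ.2.2.1, hδ.2.2.2.1,
    fun v hv => hδ.2.2.2.2 v (Metric.ball_subset_ball hle hv)⟩

/-- **`PinnedFlatRoot` is monotone in the radius.**
[cite: DuminilCopinSmirnov2012, §2 (boundary mid-edges, winding)] -/
theorem pinnedFlatRoot_of_le {D : DobrushinDomain} {Λ : ℝ → Finset HexVertex}
    {b e : ℝ → Sym2 HexVertex} {x : ℂ} {r r' : ℝ} {mr : ℝ → ℤ}
    (h : PinnedFlatRoot D Λ b x e r mr) (hr' : 0 < r') (hle : r' ≤ r) :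
    PinnedFlatRoot D Λ b x e r' mr := by
  obtain ⟨-, hflat, hev, hlim⟩ := h
  refine ⟨hr', flat_inter_ball_of_le hle hflat, ?_, hlim⟩
  filter_upwards [hev] with δ hδ
  exact ⟨hδ.1, hδ.2.1, fun v hv => hδ.2.2 v (Metric.ball_subset_ball hle hv)⟩

/-! ### 2. Eventual membership in sub-domains keeping a ball -/

/-- A domain mid-edge of `Λ` one of whose `Λ`-endpoints survives in `Λ'` is a domain mid-edge of
`Λ'`. [cite: DuminilCopinSmirnov2012, §2 (domains)] -/
theorem mem_hexDomainMidEdges_of_keep {Λ Λ' : Finset HexVertex} {e : Sym2 HexVertex}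
    (he : e ∈ hexDomainMidEdges Λ) (hkeep : ∀ v ∈ e, v ∈ Λ → v ∈ Λ') :
    e ∈ hexDomainMidEdges Λ' := by
  obtain ⟨hedge, v, hv, hvΛ⟩ := he
  exact ⟨hedge, v, hv, hkeep v hv hvΛ⟩

/-- **A pinned boundary family survives in every sub-domain keeping a ball about its limit.** If
`e δ ∈ ∂(Λ δ)` eventually and `δ·mid(e δ) → c`, then eventually, for every sub-domain
`Λ' ⊆ Λ δ` containing the faces of `Λ δ` with scaled centre in `ball c r`, `e δ ∈ ∂Λ'` (the
`Λ δ`-endpoint of `e δ` is within `δ/2` of `δ·mid(e δ)`).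
[cite: DuminilCopinSmirnov2012, §2 (domains)] -/
theorem eventually_mem_boundary_of_keep {Λ : ℝ → Finset HexVertex} {e : ℝ → Sym2 HexVertex}
    {c : ℂ} {r : ℝ} (hr : 0 < r)
    (he : ∀ᶠ δ : ℝ in 𝓝[>] 0, e δ ∈ hexDomainBoundary (Λ δ))
    (hlim : Tendsto (fun δ : ℝ => (δ : ℂ) * hexMidpoint (e δ)) (𝓝[>] 0) (𝓝 c)) :
    ∀ᶠ δ : ℝ in 𝓝[>] 0, ∀ Λ' : Finset HexVertex, Λ' ⊆ Λ δ →
      (∀ v ∈ Λ δ, (δ : ℂ) * hexCenter v ∈ Metric.ball c r → v ∈ Λ') →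
      e δ ∈ hexDomainBoundary Λ' := by
  have hnear : ∀ᶠ δ : ℝ in 𝓝[>] 0, (δ : ℂ) * hexMidpoint (e δ) ∈ Metric.ball c (r / 2) :=
    hlim (Metric.ball_mem_nhds c (half_pos hr))
  have hδ : ∀ᶠ δ : ℝ in 𝓝[>] 0, δ ∈ Set.Ioo 0 r := Ioo_mem_nhdsGT hr
  filter_upwards [he, hnear, hδ] with δ heδ hnearδ hδ Λ' hsub hkeep
  refine mem_hexDomainBoundary_of_subset hsub heδ fun v hv hvΛ => hkeep v hvΛ ?_
  refine GateMass.smul_hexCenter_mem_ball hδ.1.le heδ.1 hv ?_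
  have : dist ((δ : ℂ) * hexMidpoint (e δ)) c < r / 2 := hnearδ
  linarith [hδ.2]

/-- **Gate targets survive in every sub-domain keeping a slightly larger ball.** For `r' < r`,
eventually every domain mid-edge `z` of `Λ δ` with `δ·mid z ∈ ball c r'` is a domain mid-edge of
every sub-domain containing the faces of `Λ δ` with scaled centre in `ball c r`.
[cite: DuminilCopinSmirnov2012, §2 (domains)] -/
theorem eventually_midEdges_of_keep {Λ : ℝ → Finset HexVertex} {c : ℂ} {r r' : ℝ} (hrr : r' < r) :
    ∀ᶠ δ : ℝ in 𝓝[>] 0, ∀ Λ' : Finset HexVertex,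
      (∀ v ∈ Λ δ, (δ : ℂ) * hexCenter v ∈ Metric.ball c r → v ∈ Λ') →
      ∀ z ∈ hexDomainMidEdges (Λ δ), (δ : ℂ) * hexMidpoint z ∈ Metric.ball c r' →
        z ∈ hexDomainMidEdges Λ' := by
  have hδ : ∀ᶠ δ : ℝ in 𝓝[>] 0, δ ∈ Set.Ioo 0 (r - r') := Ioo_mem_nhdsGT (by linarith)
  filter_upwards [hδ] with δ hδ Λ' hkeep z hz hzr
  refine mem_hexDomainMidEdges_of_keep hz fun v hv hvΛ => hkeep v hvΛ ?_
  refine GateMass.smul_hexCenter_mem_ball hδ.1.le hz.1 hv ?_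
  have : dist ((δ : ℂ) * hexMidpoint z) c < r' := hzr
  linarith [hδ.2]

/-! ### Registered form (sub-goal of `stub_squeeze`) -/

/-- **Registered sub-goal `squeeze_eventualMembership`** (crux item stmt-CriticalPhenomena-14004,
line `polygon-parity-squeeze`, stub `stub_squeeze`): under the two pins of the target, the root
`a δ` and the normaliser `b δ` are eventually boundary mid-edges of the collar-deleted domain,
and every domain mid-edge of `Λ δ` with scaled midpoint in the gate half-ball `B(pt 1, ρ/2)` is
eventually a domain mid-edge of it (assembled from `…CollarDomain.lean`).
[cite: DuminilCopinSmirnov2012, §2 (domains)] -/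
theorem squeeze_eventualMembership : ∀ (D : DobrushinDomain) (ρ : ℝ) (Λ : ℝ → Finset HexVertex) (m : ℝ → ℤ) (b : ℝ → Sym2 HexVertex), AdmissibleFamily D ρ Λ m b → ∀ (a : ℝ → Sym2 HexVertex) (r₀ : ℝ) (m₀ : ℝ → ℤ), PinnedFlatRoot D Λ b (D.pt 0) a r₀ m₀ → ∀ η : ℝ, ∀ᶠ δ : ℝ in 𝓝[>] 0, a δ ∈ hexDomainBoundary (collarDomain D ρ r₀ η δ (Λ δ)) ∧ b δ ∈ hexDomainBoundary (collarDomain D ρ r₀ η δ (Λ δ)) ∧ ∀ z ∈ hexDomainMidEdges (Λ δ), (δ : ℂ) * hexMidpoint z ∈ Metric.ball (D.pt 1) (ρ / 2) → z ∈ hexDomainMidEdges (collarDomain D ρ r₀ η δ (Λ δ)) := by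
  intro D ρ Λ m b hAF a r₀ m₀ hPR η
  have hρ : 0 < ρ := hAF.1
  filter_upwards [eventually_mem_boundary_of_keep hPR.1 (hPR.2.2.1.mono fun δ h => h.1) hPR.2.2.2,
    eventually_mem_boundary_of_keep hρ (hAF.2.2.1.mono fun δ h => h.2.1) hAF.2.2.2.2,
    eventually_midEdges_of_keep (Λ := Λ) (c := D.pt 1) (half_lt_self hρ)] with δ h1 h2 h3
  refine ⟨h1 _ (collarDomain_subset D ρ r₀ η δ (Λ δ)) fun v hv hball =>
      Finset.mem_filter.2 ⟨hv, Or.inr (Or.inl hball)⟩,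
    h2 _ (collarDomain_subset D ρ r₀ η δ (Λ δ)) fun v hv hball =>
      Finset.mem_filter.2 ⟨hv, Or.inr (Or.inr hball)⟩,
    h3 _ fun v hv hball => Finset.mem_filter.2 ⟨hv, Or.inr (Or.inr hball)⟩⟩

end Summit.CriticalPhenomena.SAWScalingLimit.Theorems.PolygonParitySqueeze

end
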